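import Literature.RingTheory.Henselian.SectionsOfCardEqRank
import Mathlib.AlgebraicGeometry.Morphisms.Finite
import Mathlib.AlgebraicGeometry.Morphisms.Flat
import Mathlib.CategoryTheory.Monoidal.Cartesian.Over
import HarnessLib

/-!
# A finite flat scheme over a henselian local DOMAIN all of whose points are rational (`#G(R) = rank`): every point of the special fibre,
# with values in any field, is the reduction of a section ([SerreTate1968] §1 Lemma 1 mechanism; [StacksProject] Tags 04GG, 09HS, 01I1)

Topic `Literature/AlgebraicGeometry/GroupSchemes`, namespace `Literature.AlgebraicGeometry.GroupSchemes`.  THEOREMS ONLY (no definition, no named fact,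
no instance, no notation, no `sorry`).  SCHEME SHELL of ★ `Henselian.exists_algHom_comp_eq_of_card_algHom_eq_finrank`
(`RingTheory/Henselian/SectionsOfCardEqRank.lean`, the algebra: over a henselian local domain a finite free algebra `B` with `#(B →ₐ[R] R) = rank_R B`
has surjective reduction on points with values in any field).  Cell `pub/hodgecm-mathlib` (D-0151 ∕ D-0183 floor 0), P6 «MOD programme», sub-line P6b
«CONNECTED–ÉTALE» (`Cruxes/HLiu418/Lines/F0_P6b_ConnectedEtale.lean`): this is the banked letter **(b1dg) `reductionSurjective_ofCardSections`** of desk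
F0P6b-plan (the base-generic ∕ DVR form of `stub_b1d_reductionSurjective`, F-c2a), stated generically — for ANY field `k` under `κ(R)` and without
the idle group-object binder; generic capital `--supports stmt-HodgeConjecture-24832`.  HONEST LABEL: HC_CM is proved only modulo the printed citations
until rung 0 closes; this file pays no letter.

SETTING.  `R` a henselian local DOMAIN; `G → Spec R` FINITE and FLAT, presented by an isomorphism `eB : G ≅ Spec B` over `Spec R` (`eB ≫ Spec (R → B)
= (G → Spec R)`), as in the line's `stub_b1c`∕`stub_b1dg` texts; HYPOTHESIS `Nat.card (𝟙 ⟶ G) = rank_R B` («all `rank` points of the generic fibre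
are defined over `R`»).  Then `B` is module-finite and free over `R` (Mathlib `IsFinite.SpecMap_iff`, `HasRingHomProperty.Spec_iff` for `Flat`,
`Module.free_of_flat_of_isLocalRing`), sections `𝟙 ⟶ G` of `Over (Spec R)` are in bijection with `B →ₐ[R] R` (`Spec` is fully faithful:
Mathlib `Spec.map_surjective`, `Spec.map_inj`), a point `t₀ : Spec k → G` over `Spec k → Spec κ(R) → Spec R` is a ring map `χ : B → k` under
`φ ∘ residue`, and the ★ algebra supplies the section.

* §1 `finite_of_iso_Spec`, `flat_of_iso_Spec` — the presentation transports finiteness ∕ flatness of `G → Spec R` to `Module.Finite R B` ∕ `Module.Flat R B`;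
  `sectionOfAlgHom_bijective` — `ψ ↦ Spec ψ ≫ eB⁻¹` is a bijection `(B →ₐ[R] R) ≃ (𝟙 ⟶ G)` (stated as `Function.Bijective` of an explicit lambda), whence
  `card_sections_eq_card_algHom`.
* §2 **`exists_section_comp_eq_of_card_sections_eq_finrank`** — the head, in the binders of the banked stub (minus `[GrpObj G]`, `[IsAlgClosed k]`).

## References
* [SerreTate1968] J.-P. Serre, J. Tate, *Good reduction of abelian varieties*, Ann. of Math. 88 (1968), §1 Lemma 1.
* [StacksProject] The Stacks Project, Tag 04GG, Tag 09HS, Tag 01I1 (points of an affine scheme are ring maps).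
-/

noncomputable section

universe u

open CategoryTheory CategoryTheory.Limits AlgebraicGeometry IsLocalRing MonoidalCategory

namespace Literature.AlgebraicGeometry.GroupSchemes

section Presentation

variable {R : Type u} [CommRing R] (G : Over (Spec (CommRingCat.of R))) (B : Type u) [CommRing B] [Algebra R B]
  (eB : G.left ≅ Spec (CommRingCat.of B)) (heB : eB.hom ≫ Spec.map (CommRingCat.ofHom (algebraMap R B)) = G.hom)

include heB in
/-- `Spec (R → B) = eB⁻¹ ≫ (G → Spec R)` for a presentation `eB` of `G` over `Spec R`. [cite: StacksProject, Tag 01I1] -/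
theorem specMap_algebraMap_eq_inv_comp : Spec.map (CommRingCat.ofHom (algebraMap R B)) = eB.inv ≫ G.hom := by
  rw [← heB, Iso.inv_hom_id_assoc]

include heB in
/-- **A presentation `G ≅ Spec B` of a FINITE `G → Spec R` makes `B` module-finite over `R`.** [cite: StacksProject, Tag 01I1] -/
theorem finite_of_iso_Spec [IsFinite G.hom] : Module.Finite R B := by
  have h : IsFinite (Spec.map (CommRingCat.ofHom (algebraMap R B))) := by
    rw [specMap_algebraMap_eq_inv_comp G B eB heB]; infer_instance
  rw [IsFinite.SpecMap_iff] at h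
  exact RingHom.finite_algebraMap.mp h

include heB in
/-- **A presentation `G ≅ Spec B` of a FLAT `G → Spec R` makes `B` flat over `R`.** [cite: StacksProject, Tag 01I1] -/
theorem flat_of_iso_Spec [Flat G.hom] : Module.Flat R B := by
  have h : Flat (Spec.map (CommRingCat.ofHom (algebraMap R B))) := by
    rw [specMap_algebraMap_eq_inv_comp G B eB heB]; infer_instance
  rw [HasRingHomProperty.Spec_iff (P := @Flat)] at h
  exact RingHom.flat_algebraMap_iff.mp h

include heB in
/-- The morphism `Spec ψ ≫ eB⁻¹ : Spec R → G` of a section `ψ : B →ₐ[R] R` lies over `Spec R`. [cite: StacksProject, Tag 01I1] -/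
theorem specMap_algHom_comp_inv_comp_hom (ψ : B →ₐ[R] R) :
    (Spec.map (CommRingCat.ofHom (ψ : B →+* R)) ≫ eB.inv) ≫ G.hom = 𝟙 _ := by
  rw [Category.assoc, ← specMap_algebraMap_eq_inv_comp G B eB heB, ← Spec.map_comp, ← CommRingCat.ofHom_comp, ψ.comp_algebraMap,
    CommRingCat.ofHom_id]
  exact Spec.map_id _

include heB in
/-- **Sections of `G` are the `R`-algebra sections of `B`**: `ψ ↦ Spec ψ ≫ eB⁻¹` is a BIJECTION from `B →ₐ[R] R` onto the sections `𝟙 ⟶ G` of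
`Over (Spec R)` (`Spec` is fully faithful). [cite: StacksProject, Tag 01I1] -/
theorem sectionOfAlgHom_bijective :
    Function.Bijective fun ψ : B →ₐ[R] R =>
      (Over.homMk (Spec.map (CommRingCat.ofHom (ψ : B →+* R)) ≫ eB.inv) (specMap_algHom_comp_inv_comp_hom G B eB heB ψ) :
        𝟙_ (Over (Spec (CommRingCat.of R))) ⟶ G) := by
  refine ⟨fun ψ ψ' h => ?_, fun s => ?_⟩
  · have h1 := congrArg (fun t : 𝟙_ (Over (Spec (CommRingCat.of R))) ⟶ G => t.left ≫ eB.hom) h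
    simp only [Over.homMk_left, Category.assoc, Iso.inv_hom_id, Category.comp_id] at h1
    have h2 := Spec.map_inj.mp h1
    have h3 : (ψ : B →+* R) = (ψ' : B →+* R) := by
      have := congrArg CommRingCat.Hom.hom h2
      simpa using this
    exact AlgHom.ext fun b => RingHom.congr_fun h3 b
  · obtain ⟨χ, hχ⟩ := Spec.map_surjective (s.left ≫ eB.hom)
    have hover : CommRingCat.ofHom (algebraMap R B) ≫ χ = 𝟙 _ := by
      apply Spec.map_inj.mp
      rw [Spec.map_comp, hχ, Category.assoc, heB, Spec.map_id]
      exact Over.w s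
    let ψ : B →ₐ[R] R := AlgHom.mk χ.hom fun r => by
      have := congrArg (fun f : CommRingCat.of R ⟶ CommRingCat.of R => f.hom r) hover
      simpa using this
    refine ⟨ψ, ?_⟩
    ext : 1
    change Spec.map (CommRingCat.ofHom χ.hom) ≫ eB.inv = s.left
    rw [CommRingCat.ofHom_hom, hχ, Category.assoc, Iso.hom_inv_id, Category.comp_id]

include heB in
/-- Hence `#(𝟙 ⟶ G) = #(B →ₐ[R] R)`. [cite: StacksProject, Tag 01I1] -/
theorem card_sections_eq_card_algHom :
    Nat.card (𝟙_ (Over (Spec (CommRingCat.of R))) ⟶ G) = Nat.card (B →ₐ[R] R) :=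
  (Nat.card_eq_of_bijective _ (sectionOfAlgHom_bijective G B eB heB)).symm

end Presentation

/-- **Over a henselian local DOMAIN, a finite flat scheme all of whose points are rational has surjective reduction on points, with values in any
field.**  `R` a henselian local domain, `G → Spec R` finite flat presented by `eB : G ≅ Spec B` over `Spec R`, `Nat.card (𝟙 ⟶ G) = rank_R B`; for a
field `k`, `φ : κ(R) → k` and a point `t₀ : Spec k → G` over `Spec (φ ∘ residue)`, there is a SECTION `s : 𝟙 ⟶ G` with `Spec (φ ∘ residue) ≫ s = t₀`
— the text of desk F0P6b-plan's banked `stub_b1dg_reductionSurjective_ofCardSections` without its idle binders (`GrpObj`, `IsAlgClosed`).  Proof: ★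
`Henselian.exists_algHom_comp_eq_of_card_algHom_eq_finrank` through §1. [cite: SerreTate1968, §1 Lemma 1] [cite: StacksProject, Tag 04GG] -/
theorem exists_section_comp_eq_of_card_sections_eq_finrank {R : Type u} [CommRing R] [IsDomain R] [HenselianLocalRing R]
    (G : Over (Spec (CommRingCat.of R))) [IsFinite G.hom] [Flat G.hom]
    (B : Type u) [CommRing B] [Algebra R B] (eB : G.left ≅ Spec (CommRingCat.of B))
    (heB : eB.hom ≫ Spec.map (CommRingCat.ofHom (algebraMap R B)) = G.hom)
    (hcard : Nat.card (𝟙_ (Over (Spec (CommRingCat.of R))) ⟶ G) = Module.finrank R B)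
    {k : Type u} [Field k] (φ : ResidueField R →+* k) (t₀ : Spec (CommRingCat.of k) ⟶ G.left)
    (ht₀ : t₀ ≫ G.hom = Spec.map (CommRingCat.ofHom (φ.comp (residue R)))) :
    ∃ s : 𝟙_ (Over (Spec (CommRingCat.of R))) ⟶ G, Spec.map (CommRingCat.ofHom (φ.comp (residue R))) ≫ s.left = t₀ := by
  haveI : Module.Finite R B := finite_of_iso_Spec G B eB heB
  haveI : Module.Flat R B := flat_of_iso_Spec G B eB heB
  haveI : Module.Free R B := Module.free_of_flat_of_isLocalRing
  have hcard' : Nat.card (B →ₐ[R] R) = Module.finrank R B := by rw [← card_sections_eq_card_algHom G B eB heB, hcard]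
  -- the point as a ring map `χ : B → k` under `φ ∘ residue`
  obtain ⟨χ, hχ⟩ := Spec.map_surjective (t₀ ≫ eB.hom)
  have hχR : χ.hom.comp (algebraMap R B) = φ.comp (residue R) := by
    have h1 : Spec.map (CommRingCat.ofHom (algebraMap R B) ≫ χ) = Spec.map (CommRingCat.ofHom (φ.comp (residue R))) := by
      rw [Spec.map_comp, hχ, Category.assoc, heB, ht₀]
    have h2 := congrArg CommRingCat.Hom.hom (Spec.map_inj.mp h1)
    simpa using h2
  -- the section from the algebra
  obtain ⟨ψ, hψ⟩ := Literature.RingTheory.Henselian.exists_algHom_comp_eq_of_card_algHom_eq_finrank hcard' φ χ.hom hχR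
  refine ⟨Over.homMk (Spec.map (CommRingCat.ofHom (ψ : B →+* R)) ≫ eB.inv) (specMap_algHom_comp_inv_comp_hom G B eB heB ψ), ?_⟩
  change Spec.map (CommRingCat.ofHom (φ.comp (residue R))) ≫ (Spec.map (CommRingCat.ofHom (ψ : B →+* R)) ≫ eB.inv) = t₀
  rw [← Category.assoc, ← Spec.map_comp, ← CommRingCat.ofHom_comp, hψ, CommRingCat.ofHom_hom, hχ, Category.assoc, Iso.hom_inv_id,
    Category.comp_id]

end Literature.AlgebraicGeometry.GroupSchemes

end
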